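import Literature.NumberTheory.DiophantineGeometry.GeneralizedFermatTwoPowerCoefficientSerreProofs
import Literature.NumberTheory.DiophantineGeometry.GeneralizedFermatTwoPowerCoefficientFreyTwoProofs
import Literature.NumberTheory.Automorphic.CDTTheorem722SerreLevelProofs
import Literature.NumberTheory.EllipticCurves.BSDConductorProofs
import Literature.NumberTheory.EllipticCurves.RationalTwoTorsionModPIrreducibleProofs
import HarnessLib

/-!
# Ribet 1997, Theorem 3, along Serre's road: three named facts and two local statements (proofs)

Topic `Literature/NumberTheory/DiophantineGeometry`; fourth sibling *proofs* file (theorems only: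
no definition, no named fact, no `sorry`) of `GeneralizedFermatTwoPowerCoefficient` (named fact
`ribet1997_twoPowerFermat`: K. Ribet, *On the equation `aᵖ + 2^α bᵖ + cᵖ = 0`*, Acta Arith. 79
(1997), Thm. 3).  The sibling `…SerreProofs` proved
`ribet1997_twoPowerFermat_of_khare_wintenberger_of_frey_local`: Theorem 3 follows from Serre's
conjecture (`khare_wintenberger`) and five local statements `hirr`, `hwt`, `hlevN`, `hTate`,
`hDK` about Frey curves.  This file discharges three of them against the tree:

* `hDK` (`f₂ ≤ 3` for `4 ∣ B`, `16 ∤ B`) is the theorem `conductorExponent_freyCurve_two_le_three`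
  (`…FreyTwoProofs`: Tate's algorithm, types `I₁*` and `III*`);
* `hirr` (irreducibility of `E[p]`, `p ≥ 5`; Ribet's Prop. 1 / Serre's Prop. 6) follows from the
  catalogued Mazur–Kenku classification of rational cyclic isogenies
  (`mazurKenku_exists_cyclic_isogeny`) by
  `hasIrreducibleModPGaloisRep_freyCurve_of_mazurKenku` (`RationalTwoTorsionModPIrreducibleProofs`:
  a Frey curve has full rational `2`-torsion);
* `hlevN` (`N(ρ̄_{E,p} ⊗ k) ∣ N_E`, Serre (4.6.3)) follows, for every prime `p`, from the
  catalogued exponentwise Ogg–Saito fact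
  `WeierstrassCurve.artinConductorExponent_tate_eq_conductorExponent_of_isElliptic`
  (`a_v(V_p E) = f_v(E)`, `v ∤ p`) — `serreLevel_baseChange_dvd_conductorNorm_of_tate` below
  (the tree's `serreLevel_baseChange_dvd_conductorNorm_of_conductorNatOf` needs `N_E < p`).

Result: **`ribet1997_twoPowerFermat_of_khare_wintenberger_of_mazurKenku_of_tate`** — Ribet's
Theorem 3 from the three named facts `khare_wintenberger`, `mazurKenku_exists_cyclic_isogeny`,
`artinConductorExponent_tate_eq_conductorExponent_of_isElliptic` and the two remaining printed
local statements of Serre's dictionary for `ρ̄_{E,p}` (Serre 1987, §4.1, (4.1.11)–(4.1.12), resp.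
§2.8 Prop. 4 and (4.1.12)): the weight is `2` at a semistable `p ≥ 5` with `p ∣ ord_p Δ_min`
(`hwt`), and `ρ̄` is unramified at a semistable `ℓ ≠ p` with `p ∣ ord_ℓ Δ_min` (`hTate`, Tate
curve) — neither of which is catalogued in the tree yet.

## References

* [Ribet1997] K. A. Ribet, Acta Arith. 79 (1997), no. 1, 7–16, Thm. 3 and §§2–3.
* [Serre1987] J.-P. Serre, Duke Math. J. 54 (1987), §4.1 (4.1.11)–(4.1.13), §4.6 (4.6.3).
* [KhareWintenberger2009] C. Khare, J.-P. Wintenberger, Invent. Math. 178 (2009), Thm. 1.2.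
* [Mazur1978] B. Mazur, Invent. Math. 44 (1978), Thm. 1; [Kenku1982].
* [SerreTate1968] J.-P. Serre, J. Tate, Ann. of Math. 88 (1968), §3.
-/

noncomputable section

open scoped NumberField
open IsDedekindDomain Rat.HeightOneSpectrum

namespace Literature.NumberTheory.DiophantineGeometry

open WeierstrassCurve GaloisRepresentations EllipticCurves GaloisRepresentations.ModPGaloisRep
  GaloisRepresentations.IsNonarchimedeanLocalField ValuativeRel IsDedekindDomain.HeightOneSpectrum
  Literature.NumberTheory.Automorphic Literature.NumberTheory.Automorphic.BCDT

/-- **Serre 1987, (4.6.3): `N(ρ̄_{E,p} ⊗ k) ∣ N_E`, for every prime `p`, from the exponentwise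
Ogg–Saito fact.**  Granted `a_v(V_p E) = f_v(E)` for `v ∤ p`
(`WeierstrassCurve.artinConductorExponent_tate_eq_conductorExponent_of_isElliptic`, Serre–Tate
1968 §3, Ogg 1967, Saito 1988; proved in the tree for semistable `E`), for every elliptic `W/ℚ`,
every prime `p`, every framed model `ρ̄` of `E[p]` and every discrete field `k ⊇ 𝔽_p`:
`N(ρ̄ ⊗ k) ∣ N_E`.  Proof: `N(ρ̄ ⊗ k) ∣ N^{(p)}(V_p E)`
(`IsTorsionGaloisRep.serreLevel_baseChange_dvd_conductorNatOf`, unconditional), and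
`𝔣(E/ℚ) = 𝔣^{(p)}(V_p E) · v_p^{f_p}` (`conductor_eq_conductorOf_mul_of_artinConductorExponent`),
so `N^{(p)}(V_p E) ∣ N_{𝓞 ℚ} 𝔣(E/ℚ) = N_E` (`conductorNorm_ringOfIntegers_rat`).  Compared with
`serreLevel_baseChange_dvd_conductorNorm_of_conductorNatOf` (`CDTTheorem722SerreLevelProofs`) there
is no hypothesis `N_E < p`. [cite: Serre1987, §4.6, Lemme 5 (4.6.3)] [cite: SerreTate1968, §3] -/
theorem serreLevel_baseChange_dvd_conductorNorm_of_tate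
    (hOS : ∀ (W : WeierstrassCurve ℚ) (ℓ : ℕ) [Fact ℓ.Prime],
      W.artinConductorExponent_tate_eq_conductorExponent_of_isElliptic ℓ)
    (W : WeierstrassCurve ℚ) [W.IsElliptic] (p : ℕ) [Fact p.Prime]
    (ρ : ModPGaloisRep ℚ (ZMod p) 2) (hρ : W.IsTorsionGaloisRep p ρ)
    (k : Type*) [Field k] [TopologicalSpace k] [DiscreteTopology k] (j : ZMod p →+* k) :
    serreLevel p (FramedRep.baseChange j continuous_of_discreteTopology ρ) ∣ W.conductorNorm ℤ := by
  have hcont := W.continuous_rationalGaloisRepTate_holds p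
  have h1 := hρ.serreLevel_baseChange_dvd_conductorNatOf j continuous_of_discreteTopology hcont
  have hA : W.artinConductorExponent_tate_eq_conductorExponent p :=
    (W.artinConductorExponent_tate_eq_conductorExponent_iff_of_isElliptic p).mpr (hOS W p)
  have h2 := conductor_eq_conductorOf_mul_of_artinConductorExponent W p hA hcont
  rw [← W.conductorNorm_ringOfIntegers_rat]
  refine h1.trans ?_
  unfold conductorNatOf WeierstrassCurve.conductorNorm
  rw [h2, map_mul]
  exact dvd_mul_right _ _

/-- **Ribet 1997, Theorem 3, from `khare_wintenberger`, `mazurKenku_exists_cyclic_isogeny`, the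
exponentwise Ogg–Saito fact, and Serre's two local statements (4.1.11)/(4.1.12) for `ρ̄_{E,p}`.**
This is `ribet1997_twoPowerFermat_of_khare_wintenberger_of_frey_local` (`…SerreProofs`) with
`hirr` supplied by `hasIrreducibleModPGaloisRep_freyCurve_of_mazurKenku`, `hlevN` by
`serreLevel_baseChange_dvd_conductorNorm_of_tate`, and `hDK` by the theorem
`conductorExponent_freyCurve_two_le_three` (`…FreyTwoProofs`).  Remaining hypotheses, all printed
statements: `hKW` — Serre's conjecture (3.2.4?) = Khare–Wintenberger 2009 Thm. 1.2 (named fact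
`khare_wintenberger`); `hMK` — Mazur 1978 Thm. 1 with Kenku 1982 (named fact); `hOS` —
`a_v(V_ℓ E) = f_v(E)` (named fact, Serre–Tate 1968 §3 / Ogg–Saito); `hwt` — Serre 1987 §2.8
Prop. 4 with (4.1.11): `k(ρ̄_{E,p}) = 2` for `E` semistable at `p ≥ 5` with `p ∣ ord_p Δ_min`;
`hTate` — Serre 1987 (4.1.12): `ρ̄_{E,p}` is unramified at a semistable `ℓ ≠ p` with
`p ∣ ord_ℓ Δ_min` (Tate curve). [cite: Ribet1997, Thm. 3, §§2–3]
[cite: Serre1987, §4.1 (4.1.11)–(4.1.12), §4.6 (4.6.3)] [cite: KhareWintenberger2009, Thm. 1.2] -/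
theorem ribet1997_twoPowerFermat_of_khare_wintenberger_of_mazurKenku_of_tate
    (hKW : ∀ (p : ℕ) [Fact p.Prime] (k : Type) [Field k] [TopologicalSpace k] [DiscreteTopology k],
      khare_wintenberger p k)
    (hMK : mazurKenku_exists_cyclic_isogeny)
    (hOS : ∀ (W : WeierstrassCurve ℚ) (ℓ : ℕ) [Fact ℓ.Prime],
      W.artinConductorExponent_tate_eq_conductorExponent_of_isElliptic ℓ)
    (hwt : ∀ (W : WeierstrassCurve ℚ) [W.IsElliptic] (p : ℕ) [Fact p.Prime], 5 ≤ p →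
      W.IsSemistableAt ((primesEquiv (R := ℤ)).symm ⟨p, Fact.out⟩) →
      p ∣ W.ordMinimalDiscriminant ((primesEquiv (R := ℤ)).symm ⟨p, Fact.out⟩) →
      ∀ ρ : ModPGaloisRep ℚ (ZMod p) 2, W.IsTorsionGaloisRep p ρ →
        ∀ (k : Type) [Field k] [TopologicalSpace k] [DiscreteTopology k] [CharP k p]
          [IsAlgClosed k] (j : ZMod p →+* k)
          (loc : LocalRestrictionAt p (FramedRep.baseChange j continuous_of_discreteTopology ρ))
          (ι : absIntegers 𝒪[loc.F] loc.F ⧸ absMaximalIdeal loc.F →+* k),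
          serreWeight p (FramedRep.baseChange j continuous_of_discreteTopology ρ) loc ι = 2)
    (hTate : ∀ (W : WeierstrassCurve ℚ) [W.IsElliptic] (p : ℕ) [Fact p.Prime],
      ∀ ρ : ModPGaloisRep ℚ (ZMod p) 2, W.IsTorsionGaloisRep p ρ →
        ∀ (k : Type) [Field k] [TopologicalSpace k] [DiscreteTopology k] [CharP k p]
          [IsAlgClosed k] (j : ZMod p →+* k) (v : HeightOneSpectrum ℤ),
          natGenerator v ≠ p → W.IsSemistableAt v → p ∣ W.ordMinimalDiscriminant v →
            ¬ natGenerator v ∣ serreLevel p (FramedRep.baseChange j continuous_of_discreteTopology ρ)) :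
    ribet1997_twoPowerFermat :=
  ribet1997_twoPowerFermat_of_khare_wintenberger_of_frey_local hKW
    (fun _ _ _ hp h5 _ h0 _ _ ↦ hasIrreducibleModPGaloisRep_freyCurve_of_mazurKenku hMK h0 hp h5)
    (fun W _ p _ h5 hs hd ρ hρ k _ _ _ _ _ j loc ι ↦ hwt W p h5 hs hd ρ hρ k j loc ι)
    (fun W _ p _ ρ hρ k _ _ _ _ _ j ↦
      serreLevel_baseChange_dvd_conductorNorm_of_tate hOS W p ρ hρ k j)
    (fun W _ p _ ρ hρ k _ _ _ _ _ j v hv hs hd ↦ hTate W p ρ hρ k j v hv hs hd)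
    conductorExponent_freyCurve_two_le_three

end Literature.NumberTheory.DiophantineGeometry
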